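import Literature.AlgebraicGeometry.Frobenioids.ArchimedeanConjRotation
import HarnessLib

/-!
# Frobenioids II, Theorem 3.6 (i)/(ii), the "ample" clauses — `C₀`-level construction: an isometric
# linear endomorphism of an object of `C₀` over ANY endomorphism of its base; twisted objects

Mochizuki, *The geometry of Frobenioids II*, Kyushu J. Math. **62** (2008) 401–460, §3, Theorem 3.6 (i)
p. 36 / (ii) p. 37 [cite: MochizukiFrdII2008, Thm 3.6 (i) p.36]: "the Frobenioid `C^Λ` [resp. `A`] is of
`Aut`-ample, `Aut^sub`-ample, `End`-ample […] type"; proof p. 38: "By [the earlier portion of] Lemma 3.2,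
(ii), it is immediate from the construction of `C^Λ` […]".

On the model `C₀` of Example 3.3 (i) (abc-iut-L1-t6's `ArchimedeanFrobenioids.lean`): for an object
`X = (Spec K, V_K, A_K)` and an endomorphism `g` of `Spec K` in `D₀` (the identity or complex
conjugation), the ISOMETRIC LINEAR endomorphism `liftEnd X g = (g, 1, c_g)` of `X` over `g`, where over
conjugation `c_g = c(A_K)` is the conjugation rotation of `ArchimedeanConjRotation.lean` (Lemma 3.2 (ii));
`g ↦ liftEnd X g` is multiplicative and involutive. For the `Aut^sub` clause: the object `X|_b` obtained by
twisting the angular region along `b : Spec L → Spec K` (Def. 3.1 (iv)), the tautological isometry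
`X|_b → X`, and the transport `twistLiftEnd` of `liftEnd X g` along it for a commuting square
`g' ≫ b = b ≫ g`. Everything is PROVED; the clauses of Thm. 3.6 (i)/(ii) themselves are discharged in
`ArchimedeanAmpleness.lean`. No statement of the paper is strengthened.
-/

namespace Literature.AlgebraicGeometry.Frobenioids

open CategoryTheory
open scoped Pointwise

noncomputable section

namespace ArchFrd

namespace C0

variable {X Y : C0}

/-! ### `liftEnd`: an isometric linear endomorphism over any endomorphism of the base -/

/-- The canonical endomorphism `(g, 1, c_g)` of `X ∈ Ob(C₀)` over an endomorphism `g` of `Base(X)`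
(proof of Thm. 3.6 (i), p. 38, via Lemma 3.2 (ii)). [cite: MochizukiFrdII2008, Thm 3.6 (i) p.38] -/
def liftEnd (X : C0) (g : X.base ⟶ X.base) : X ⟶ X where
  base := g
  degFr := 1
  scalar := X.region.twistScalar (D0.Hom.twists g)
  scalar_mem := X.region.twistScalar_mem_scalars g
  mapsTo := by
    rw [PNat.one_coe, pow_one, AngularRegion.twistScalar_smul_carrier]
    exact fun u hu => hu

/-- `Base(liftEnd g) = g`. [cite: MochizukiFrdII2008, Thm 3.6 (i) p.38] -/
@[simp] theorem base_liftEnd (X : C0) (g : X.base ⟶ X.base) : Base (liftEnd X g) = g := rfl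

/-- `deg_Fr(liftEnd g) = 1`. [cite: MochizukiFrdII2008, Thm 3.6 (i) p.38] -/
@[simp] theorem degFr_liftEnd (X : C0) (g : X.base ⟶ X.base) : degFr (liftEnd X g) = 1 := rfl

/-- The scalar of `liftEnd g`. [cite: MochizukiFrdII2008, Thm 3.6 (i) p.38] -/
theorem scalar_liftEnd (X : C0) (g : X.base ⟶ X.base) :
    scalar (liftEnd X g) = X.region.twistScalar (D0.Hom.twists g) := rfl

/-- `liftEnd id = id`. [cite: MochizukiFrdII2008, Thm 3.6 (i) p.38] -/
theorem liftEnd_id (X : C0) : liftEnd X (𝟙 X.base) = 𝟙 X := by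
  refine hom_ext rfl rfl ?_
  rw [scalar_liftEnd, scalar_id', D0.twists_id]
  rfl

/-- The twist of a composite of endomorphisms of `D₀` is the sum of the twists.
[cite: MochizukiFrdII2008, Def 3.1 (i) p.23] -/
theorem twists_endo_comp {K : D0} (g g' : K ⟶ K) :
    D0.Hom.twists (g ≫ g') = xor (D0.Hom.twists g) (D0.Hom.twists g') := by
  cases g with
  | idReal => rw [D0.hom_real_real_eq_id g', Category.comp_id]; rfl
  | gal σ =>
    cases g' with
    | gal τ => rfl

/-- `liftEnd` is multiplicative: `liftEnd g ≫ liftEnd g' = liftEnd (g ≫ g')`.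
[cite: MochizukiFrdII2008, Thm 3.6 (i) p.38] -/
theorem liftEnd_comp (X : C0) (g g' : X.base ⟶ X.base) :
    liftEnd X g ≫ liftEnd X g' = liftEnd X (g ≫ g') := by
  refine hom_ext rfl (mul_one _) ?_
  rw [scalar_comp', scalar_liftEnd, scalar_liftEnd, scalar_liftEnd, degFr_liftEnd, PNat.one_coe, pow_one,
    base_liftEnd, twists_endo_comp]
  exact X.region.galAct_twistScalar_mul _ _

/-- `liftEnd g` is an involution. [cite: MochizukiFrdII2008, Thm 3.6 (i) p.38] -/
theorem liftEnd_comp_self (X : C0) (g : X.base ⟶ X.base) : liftEnd X g ≫ liftEnd X g = 𝟙 X := by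
  rw [liftEnd_comp, D0.endo_comp_self, liftEnd_id]

/-- `liftEnd g` as an automorphism of `X`. [cite: MochizukiFrdII2008, Thm 3.6 (i) p.38] -/
def liftAut (X : C0) (g : X.base ⟶ X.base) : X ≅ X :=
  ⟨liftEnd X g, liftEnd X g, liftEnd_comp_self X g, liftEnd_comp_self X g⟩

/-- `liftEnd g` is an isometry (`|c_g| · tip = tip`). [cite: MochizukiFrdII2008, Thm 3.6 (i) p.38] -/
theorem isIsometry_liftEnd (X : C0) (g : X.base ⟶ X.base) :
    PreFrobenioid.IsIsometry C0.toElem (liftEnd X g) := by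
  rw [A0.isIsometry_iff_norm_mul_tip_pow, scalar_liftEnd, AngularRegion.norm_twistScalar, one_mul,
    degFr_liftEnd, PNat.one_coe, pow_one]

/-! ### Twisting an object of `C₀` along an arrow of `D₀` -/

/-- `X|_b ∈ Ob(C₀)`: the object over `Spec L` obtained from `X = (Spec K, V_K, A_K)` along
`b : Spec L → Spec K` — `(Spec L, V_K ⊗_K L, A_K|_L)` with `A_K|_L` read in `ℂ^×` as the Galois image
(Def. 3.1 (iv); for `L` real, `K` is real and the region isotropic). [cite: MochizukiFrdII2008, Def 3.1 (iv) p.24] -/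
def twistObj (X : C0) {L : D0} (b : L ⟶ X.base) : C0 where
  base := L
  region := X.region.twist (D0.Hom.twists b)
  isIsotropic_of_isReal hL := by
    subst hL
    rcases X with ⟨K, R, hR⟩
    cases K with
    | real => exact AngularRegion.isIsotropic_twist (hR rfl) _
    | complex => exact (D0.isEmpty_hom_real_complex.false b).elim

/-- The carrier of `X|_b` is `A_K|_L = b(A_K)`. [cite: MochizukiFrdII2008, Def 3.1 (iv) p.24] -/
theorem carrier_twistObj (X : C0) {L : D0} (b : L ⟶ X.base) :
    (X.twistObj b).region.carrier = pullRegion X b :=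
  X.region.carrier_twist _

/-- `X|_b` has the same tip as `X`. [cite: MochizukiFrdII2008, Def 3.1 (iv) p.24] -/
@[simp] theorem tip_twistObj (X : C0) {L : D0} (b : L ⟶ X.base) : (X.twistObj b).tip = X.tip :=
  congrArg (fun t : PosReal => (t : ℝ)) (X.region.tip_twist _)

/-- The tautological arrow `(b, 1, 1) : X|_b → X` of `C₀`. [cite: MochizukiFrdII2008, Ex 3.3 (i) p.27] -/
def twistHom (X : C0) {L : D0} (b : L ⟶ X.base) : X.twistObj b ⟶ X where
  base := b
  degFr := 1
  scalar := 1
  scalar_mem := one_mem _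
  mapsTo := by
    rw [one_smul, PNat.one_coe, pow_one, carrier_twistObj]
    exact fun u hu => hu

/-- `(b, 1, 1) : X|_b → X` is an isometry (same tip). [cite: MochizukiFrdII2008, Ex 3.3 (iii) p.28] -/
theorem isIsometry_twistHom (X : C0) {L : D0} (b : L ⟶ X.base) :
    PreFrobenioid.IsIsometry C0.toElem (X.twistHom b) := by
  rw [A0.isIsometry_iff_norm_mul_tip_pow]
  change ‖((1 : ℂˣ) : ℂ)‖ * (X.twistObj b).tip ^ ((1 : ℕ+) : ℕ) = X.tip
  rw [Units.val_one, norm_one, one_mul, PNat.one_coe, pow_one, tip_twistObj]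

/-- Transport of `liftEnd X g` along `X|_b → X`: for a commuting square `g' ≫ b = b ≫ g` of `D₀`, the
endomorphism `(g', 1, b(c_g))` of `X|_b` over `g'`. Its angular condition: `b(c_g) · b(A_K) ⊆ g'(b(A_K))`,
from `c_g · A_K ⊆ g(A_K)` — the twists of `g`, `g'` agree unless `K` is real, where `A_K` is isotropic.
[cite: MochizukiFrdII2008, Thm 3.6 (i) p.38] -/
def twistLiftEnd (X : C0) {L : D0} (b : L ⟶ X.base) (g' : L ⟶ L) (g : X.base ⟶ X.base)
    (h : g' ≫ b = b ≫ g) : X.twistObj b ⟶ X.twistObj b where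
  base := g'
  degFr := 1
  scalar := b.act (X.region.twistScalar (D0.Hom.twists g))
  scalar_mem := act_mem_scalars b (X.region.twistScalar_mem_scalars g)
  mapsTo := by
    rw [PNat.one_coe, pow_one, carrier_twistObj]
    change b.act _ • (b.act '' X.region.carrier) ⊆ g'.act '' ((X.twistObj b).region.carrier)
    rw [carrier_twistObj, ← Set.image_smul_distrib, AngularRegion.twistScalar_smul_carrier]
    change D0.galAct (D0.Hom.twists b) '' (D0.galAct (D0.Hom.twists g) '' X.region.carrier) ⊆
      D0.galAct (D0.Hom.twists g') '' (D0.galAct (D0.Hom.twists b) '' X.region.carrier)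
    rcases D0.twists_eq_or_eq_real b g g' h with hσ | hK
    · rw [hσ, Set.image_image, Set.image_image]
      exact subset_of_eq (Set.image_congr' fun u => D0.galAct_comm _ _ u)
    · have hX : X.region.IsIsotropic := X.isIsotropic_of_isReal hK
      rw [image_galAct_of_isIsotropic hX, image_galAct_of_isIsotropic hX, image_galAct_of_isIsotropic hX]

/-- The transported endomorphism commutes with `liftEnd X g` through `X|_b → X`.
[cite: MochizukiFrdII2008, Thm 3.6 (i) p.38] -/
theorem twistLiftEnd_comm (X : C0) {L : D0} (b : L ⟶ X.base) (g' : L ⟶ L) (g : X.base ⟶ X.base)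
    (h : g' ≫ b = b ≫ g) : X.twistLiftEnd b g' g h ≫ X.twistHom b = X.twistHom b ≫ X.liftEnd g := by
  refine hom_ext h rfl ?_
  rw [scalar_comp', scalar_comp']
  change g'.act 1 * b.act (X.region.twistScalar (D0.Hom.twists g)) ^ ((1 : ℕ+) : ℕ) =
    b.act (X.region.twistScalar (D0.Hom.twists g)) * 1 ^ ((1 : ℕ+) : ℕ)
  rw [map_one, one_mul, PNat.one_coe, pow_one, one_pow, mul_one]

/-- The transported endomorphism is an involution. [cite: MochizukiFrdII2008, Thm 3.6 (i) p.38] -/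
theorem twistLiftEnd_comp_self (X : C0) {L : D0} (b : L ⟶ X.base) (g' : L ⟶ L) (g : X.base ⟶ X.base)
    (h : g' ≫ b = b ≫ g) : X.twistLiftEnd b g' g h ≫ X.twistLiftEnd b g' g h = 𝟙 _ := by
  refine hom_ext (D0.endo_comp_self g') rfl ?_
  rw [scalar_comp', scalar_id']
  change g'.act (b.act (X.region.twistScalar (D0.Hom.twists g))) *
      b.act (X.region.twistScalar (D0.Hom.twists g)) ^ ((1 : ℕ+) : ℕ) = 1
  rw [PNat.one_coe, pow_one]
  change D0.galAct (D0.Hom.twists g') (D0.galAct (D0.Hom.twists b) _) * D0.galAct (D0.Hom.twists b) _ = 1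
  rcases D0.twists_eq_or_eq_real b g g' h with hσ | hK
  · rw [hσ, D0.galAct_comm, ← map_mul, AngularRegion.galAct_twistScalar_mul, Bool.xor_self]
    exact map_one _
  · rw [D0.twists_eq_false_of_eq_real hK g]
    change D0.galAct _ (D0.galAct _ 1) * D0.galAct _ 1 = 1
    rw [map_one, map_one, mul_one]

end C0

end ArchFrd

end

end Literature.AlgebraicGeometry.Frobenioids
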